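import Summits.MatrixMultiplication.MatrixMultiplication.Theorems.ObstructionDescentEvenSplitDescent

set_option linter.dupNamespace false

/-!
# Obstruction descent, part X — SPLIT BOUNDARY: the even Strassen step, and split coefficients are exactly the
# boundary obstructions

`route-MatrixMultiplication-ObstructionDescent`, aside `InvariantSaturation` (stmt 32282); decomp-mm lens-3, NODE-g16; the
kernel form of the EVEN-STEP LAW of NODE-g15 §1e (E5) («H20(N) ∧ k_{N−1}(3) = 0 ⟹ r_N(3) ≥ 3N/2 + 1», `N = 8 → 13` = census K25),
companion of part W (the ODD step «H20(N−1) ⟹ r_N(3) ≥ (3N+1)/2»).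

THE MECHANISM OF THE TOWER'S LOWER BOUNDS, ONE STEP FURTHER.  Parts H/I/U bound a full-format level-`k` vector `f` (type
`((k^N))³`, degree `kN`) on `σ_r` through PARTIAL DEGREES of its secant polynomial `Φ(λ) = f(Σ_{i<r} λ_i t_i)`: a dead unit
window gives `deg_{λ_i} Φ ≤ k − 1`, and a polynomial in `r` variables with partial degrees `≤ δ = k − 1` and total degree `kN`
vanishes when `δ·r < kN` (cube law / descent law).  AT THE BOUNDARY `δ·r = kN` exactly one monomial survives, `Π_i λ_i^δ`, and
its coefficient — the SPLIT COEFFICIENT `[Π λ_i^{k−1}] f(Σ λ_i t_i)` (for `k = 3`: the EVEN-SPLIT coefficient of H20) — is the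
whole obstruction.  This file proves:

* §1 NECESSITY (`secant_eq_zero_of_vanish`, `coeff_secant_eq_zero_of_vanish`): if `f` vanishes on all tensors of rank `≤ r`,
  EVERY coefficient of its secant polynomial at any `r` triads vanishes — split hypotheses are necessary conditions for the
  boundary step, with no emptiness input at all (so H20-self(`N`) is implied by `R₃(N) ⊆ I(σ_{3N/2})`);
* §2 the BOUNDARY CUBE LAW (`evalT_eq_zero_of_coordDegree_boundary`, `evalT_eq_zero_of_unitWindow_boundary`): coordinate
  degree `≤ δ` along one cell through every point + vanishing split coefficients at `δ r = D` ⇒ `f ∈ I(σ_r)` for `δ r ≤ D`;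
* §3 the BOUNDARY DESCENT LAW = EVEN-STEP LAW for every level `k` (`evalT_eq_zero_of_emptyLevel_pred_boundary`): `k` empty at
  format `m'` + the self-split hypothesis for `f` at format `m' + 1` ⇒ `f(t) = 0` for `R(t) ≤ r`, `(k−1) r ≤ k(m'+1)` (part U
  is the strict case `(k−1) r < k(m'+1)`, where the split hypothesis is not consulted);
* §4 FORMAT BOOKKEEPING (`secant_liftPoly`, `cornerSplit_iff_selfSplit`): the split hypothesis for the corner type
  `((k^N))³ ⊂` format `m ≥ N` (the shape of part W's `hES`) is equivalent to the self-format one — so part W's hypothesis at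
  `m' ↦ N` and this file's hypothesis at format `N` are the same statement H20(`N`);
* §5 LEVEL 3: the even step `evalT_eq_zero_of_evenStep` (`3 ∈ emptyLevels m' m'` ∧ H20-self(`m'+1`) ⇒ `R₃(m'+1) ⊆ I(σ_r)` for
  `2r ≤ 3(m'+1)`), its corner / point-level / orbit / passing-level forms, the EQUIVALENCE at the boundary
  (`level_three_vanishing_iff_selfSplit`: given `k_{N−1}(3) = 0` and `2r = 3N`, `R₃(N) ⊆ I(σ_r) ⟺ H20(N)`), vacuity for odd
  formats, and the instance `N = 8`: `thirteen_le_tensorRank_of_level_three_eight` — **`r₈(3) ≥ 13` from the two named census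
  facts `k₇(3) = 0` and H20(8)** (census K25: `r₈(3) = 13` exactly, the one failure of the naive law `⌈3N/2⌉`).

[cite: BurgisserIkenmeyer2011, §6.2] (Strassen's `σ_4`-range; the level-3 column), [cite: BurgisserIkenmeyer2017, §5 (5.2),
Thm 5.3] (levels of a point), [cite: LandsbergGCT2017, §8.3.4] (prolongation / polarisation: coefficients of secant polynomials).
-/

open scoped BigOperators
open Finset

namespace Summit.MatrixMultiplication.MatrixMultiplication.Theorems.ObstructionCalculus

open Literature.Computability.AlgebraicComplexity (actTensor triad triad_apply tensorRank unitTensor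
  exists_eq_sum_triad_of_tensorRank_le tensorRank_le_of_eq_sum tensorRestrictsTo_actTensor TensorRestrictsTo)

/-! ### §1 Necessity: a polynomial vanishing on `σ_r` has identically vanishing secant polynomials at `r` triads -/

section Necessity

variable {m : ℕ}

/-- A weighted sum of `r` triads has rank `≤ r`. [bookkeeping] -/
theorem tensorRank_sum_smul_triad_le {r : ℕ} (c : Fin r → ℂ) (x₁ x₂ x₃ : Fin r → Fin m → ℂ) :
    tensorRank (∑ i, c i • (triad (x₁ i) (x₂ i) (x₃ i) : Tensor ℂ m)) ≤ r :=
  tensorRank_le_of_eq_sum (fun i => c i • x₁ i) x₂ x₃ (Finset.sum_congr rfl fun i _ => smul_triad (c i) _ _ _)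

/-- **Necessity of split hypotheses.**  If `f` vanishes at every tensor of rank `≤ r`, then its secant polynomial
`f(Σ_{i<r} λ_i t_i) ∈ ℂ[λ]` at ANY `r` rank-one tensors `t_i` is the zero polynomial (it vanishes at every `λ ∈ ℂ^r`).
[this node] -/
theorem secant_eq_zero_of_vanish {r : ℕ} {f : MvPolynomial (Idx m) ℂ}
    (hvan : ∀ t : Tensor ℂ m, tensorRank t ≤ r → evalT t f = 0) (x₁ x₂ x₃ : Fin r → Fin m → ℂ) :
    MvPolynomial.aeval (fun p : Idx m =>
      ∑ i : Fin r, MvPolynomial.C (triad (x₁ i) (x₂ i) (x₃ i) p.1 p.2.1 p.2.2) * MvPolynomial.X i) f = 0 := by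
  refine MvPolynomial.funext fun c => ?_
  rw [map_zero]
  exact (eval_secant (fun i => (triad (x₁ i) (x₂ i) (x₃ i) : Tensor ℂ m)) f c).trans
    (hvan _ (tensorRank_sum_smul_triad_le c x₁ x₂ x₃))

/-- In particular every coefficient of the secant polynomial vanishes — e.g. the split coefficient `[Π_i λ_i^δ]`: H20-type
hypotheses are NECESSARY for membership in `I(σ_r)`, with no emptiness input. [this node] -/
theorem coeff_secant_eq_zero_of_vanish {r : ℕ} {f : MvPolynomial (Idx m) ℂ}
    (hvan : ∀ t : Tensor ℂ m, tensorRank t ≤ r → evalT t f = 0) (x₁ x₂ x₃ : Fin r → Fin m → ℂ) (s : Fin r →₀ ℕ) :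
    MvPolynomial.coeff s (MvPolynomial.aeval (fun p : Idx m =>
      ∑ i : Fin r, MvPolynomial.C (triad (x₁ i) (x₂ i) (x₃ i) p.1 p.2.1 p.2.2) * MvPolynomial.X i) f) = 0 := by
  rw [secant_eq_zero_of_vanish hvan, MvPolynomial.coeff_zero]

end Necessity

/-! ### §2 The boundary cube law -/

section Boundary

variable {m : ℕ}

/-- **BOUNDARY CUBE LAW (general type).**  Let `f` be a weight vector of a slotwise-constant type `Λ` in degree `D` whose
degree along ONE coordinate direction `e_{abc}` through EVERY point is `≤ δ`, and let `δ·r ≤ D`.  If, in the boundary case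
`δ·r = D`, the split coefficient `[Π_i λ_i^δ] f(Σ_{i<r} λ_i t_i)` vanishes for all `r`-tuples of triads `t_i`, then `f`
vanishes at every tensor of rank `≤ r`.  (Part H `evalT_eq_zero_of_coordDegree` is the strict case `δ·r < D`.) [this node] -/
theorem evalT_eq_zero_of_coordDegree_boundary {Λ : Fin 3 → Fin m → ℕ} {D δ : ℕ} {f : MvPolynomial (Idx m) ℂ}
    (hf : f ∈ hwvSpace Λ D) (hΛ : ∀ (s : Fin 3) (i j : Fin m), Λ s i = Λ s j) {a b c : Fin m}
    (hdeg : ∀ y : Tensor ℂ m, ∃ Q : Polynomial ℂ, Q.natDegree ≤ δ ∧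
      ∀ u : ℂ, evalT (y + u • triad (Pi.single a 1) (Pi.single b 1) (Pi.single c 1)) f = Q.eval u)
    {r : ℕ} (hr : δ * r ≤ D)
    (hsplit : ∀ (x₁ x₂ x₃ : Fin r → Fin m → ℂ), δ * r = D →
      MvPolynomial.coeff (Finsupp.equivFunOnFinite.symm fun _ : Fin r => δ)
        (MvPolynomial.aeval (fun p : Idx m =>
          ∑ i : Fin r, MvPolynomial.C (triad (x₁ i) (x₂ i) (x₃ i) p.1 p.2.1 p.2.2) * MvPolynomial.X i) f) = 0)
    {t : Tensor ℂ m} (ht : tensorRank t ≤ r) : evalT t f = 0 := by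
  obtain ⟨w, u, v, rfl⟩ := exists_eq_sum_triad_of_tensorRank_le ht
  set T : Fin r → Tensor ℂ m := fun i => triad (w i) (u i) (v i) with hT
  have hline : ∀ (y : Tensor ℂ m) (i : Fin r), ∃ Q : Polynomial ℂ, Q.natDegree ≤ δ ∧
      ∀ s : ℂ, evalT (y + s • T i) f = Q.eval s := by
    intro y i
    by_cases h0 : w i = 0 ∨ u i = 0 ∨ v i = 0
    · refine ⟨Polynomial.C (evalT y f), (Polynomial.natDegree_C _).le.trans (Nat.zero_le _), fun s => ?_⟩
      rw [hT]
      simp only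
      rw [triad_eq_zero_of_factor h0, smul_zero, add_zero, Polynomial.eval_C]
    · have h0' : w i ≠ 0 ∧ u i ≠ 0 ∧ v i ≠ 0 :=
        ⟨fun h => h0 (Or.inl h), fun h => h0 (Or.inr (Or.inl h)), fun h => h0 (Or.inr (Or.inr h))⟩
      obtain ⟨A, B, C, hA, hB, hC, hABC⟩ := exists_actTensor_coord_eq_triad h0'.1 h0'.2.1 h0'.2.2 a b c
      obtain ⟨χ, -, hχ⟩ := exists_evalT_actTensor_eq_mul hf hΛ hA hB hC
      have h := lineDegree_actTensor hA hB hC hχ hdeg y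
      rw [hABC] at h
      rw [hT]
      exact h
  have hΦ : MvPolynomial.aeval
      (fun p : Idx m => ∑ i : Fin r, MvPolynomial.C (T i p.1 p.2.1 p.2.2) * MvPolynomial.X i) f = 0 :=
    secant_eq_zero_of_coeff hf.1 T hline hr fun hD => hsplit w u v hD
  have h := eval_secant T f fun _ => 1
  rw [hΦ, map_zero] at h
  simpa only [one_smul] using h.symm

/-- **BOUNDARY CUBE LAW for full-format level vectors.**  A level-`k` vector `f` of the full format `m` (type `((k^m))³`,
degree `km`) with a DEAD UNIT WINDOW at some cell — `f(y⁰ + e_{abc}) = 0` for all `y⁰` off the slices through `(a,b,c)` — and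
vanishing split coefficients `[Π_i λ_i^{k−1}] f(Σ λ_i t_i)` at `(k−1)·r = k·m` vanishes at every tensor of rank `≤ r` with
`(k−1)·r ≤ k·m` (part I `evalT_eq_zero_of_unitWindow`: the strict case). [this node] -/
theorem evalT_eq_zero_of_unitWindow_boundary {k : ℕ} {f : MvPolynomial (Idx m) ℂ}
    (hf : f ∈ hwvSpace (rectType m m k) (k * m)) {a b c : Fin m}
    (hdead : ∀ y : Tensor ℂ m,
      evalT ((fun x y' z => if x = a ∨ y' = b ∨ z = c then 0 else y x y' z) +
        triad (Pi.single a 1) (Pi.single b 1) (Pi.single c 1)) f = 0)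
    {r : ℕ} (hr : (k - 1) * r ≤ k * m)
    (hsplit : ∀ (x₁ x₂ x₃ : Fin r → Fin m → ℂ), (k - 1) * r = k * m →
      MvPolynomial.coeff (Finsupp.equivFunOnFinite.symm fun _ : Fin r => k - 1)
        (MvPolynomial.aeval (fun p : Idx m =>
          ∑ i : Fin r, MvPolynomial.C (triad (x₁ i) (x₂ i) (x₃ i) p.1 p.2.1 p.2.2) * MvPolynomial.X i) f) = 0)
    {t : Tensor ℂ m} (ht : tensorRank t ≤ r) : evalT t f = 0 :=
  evalT_eq_zero_of_coordDegree_boundary hf (fun s i j => rectType_self_const k s i j)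
    (coordDegree_of_unitWindow hf (rectType_self_apply k 0 a) (rectType_self_apply k 1 b) (rectType_self_apply k 2 c)
      hdead) hr hsplit ht

end Boundary

/-! ### §3 The boundary descent law (even step) at every level -/

section BoundaryDescent

variable {m' : ℕ}

/-- **BOUNDARY DESCENT LAW (the even step, every level).**  If level `k` is EMPTY at format `m'` (so the unit window at
`(0,0,0)` of every level-`k` vector of the full format `m' + 1` is dead, part U), and the split coefficients of `f` at
`(k−1)·r = k(m'+1)` vanish, then `f(t) = 0` for every `t` of rank `≤ r`, `(k−1)·r ≤ k(m'+1)`.  Part U's descent law is the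
strict range `(k−1)·r < k(m'+1)`; at the boundary the split coefficient is the whole obstruction (§1). [this node] -/
theorem evalT_eq_zero_of_emptyLevel_pred_boundary {k : ℕ} (hk : k ∈ emptyLevels m' m')
    {f : MvPolynomial (Idx (m' + 1)) ℂ} (hf : f ∈ hwvSpace (rectType (m' + 1) (m' + 1) k) (k * (m' + 1)))
    {r : ℕ} (hr : (k - 1) * r ≤ k * (m' + 1))
    (hsplit : ∀ (x₁ x₂ x₃ : Fin r → Fin (m' + 1) → ℂ), (k - 1) * r = k * (m' + 1) →
      MvPolynomial.coeff (Finsupp.equivFunOnFinite.symm fun _ : Fin r => k - 1)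
        (MvPolynomial.aeval (fun p : Idx (m' + 1) =>
          ∑ i : Fin r, MvPolynomial.C (triad (x₁ i) (x₂ i) (x₃ i) p.1 p.2.1 p.2.2) * MvPolynomial.X i) f) = 0)
    {t : Tensor ℂ (m' + 1)} (ht : tensorRank t ≤ r) : evalT t f = 0 :=
  evalT_eq_zero_of_unitWindow_boundary hf (a := 0) (b := 0) (c := 0)
    (fun y => evalT_unitWindow_eq_zero_of_emptyLevel_pred hk hf y) hr hsplit ht

end BoundaryDescent

/-! ### §4 Format bookkeeping: split hypotheses for corner types are the self-format ones -/

section FormatBookkeeping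

variable {m : ℕ}

/-- The secant polynomial of a lifted polynomial at triads is the secant polynomial of the original at the CORNER parts of
the vectors. [bookkeeping] -/
theorem secant_liftPoly {d r : ℕ} (x₁ x₂ x₃ : Fin r → Fin (d + m) → ℂ) (f : MvPolynomial (Idx m) ℂ) :
    MvPolynomial.aeval (fun p : Idx (d + m) =>
      ∑ i : Fin r, MvPolynomial.C (triad (x₁ i) (x₂ i) (x₃ i) p.1 p.2.1 p.2.2) * MvPolynomial.X i) (liftPoly d f) =
    MvPolynomial.aeval (fun p : Idx m =>
      ∑ i : Fin r, MvPolynomial.C (triad (x₁ i ∘ Fin.natAdd d) (x₂ i ∘ Fin.natAdd d) (x₃ i ∘ Fin.natAdd d)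
        p.1 p.2.1 p.2.2) * MvPolynomial.X i) f := by
  unfold liftPoly
  rw [MvPolynomial.aeval_rename]
  rfl

/-- Zero-padding a vector below and reading its corner part gives the vector back. [bookkeeping] -/
theorem append_zero_comp_natAdd {d : ℕ} (x : Fin m → ℂ) :
    (Fin.append (fun _ : Fin d => (0 : ℂ)) x) ∘ Fin.natAdd d = x :=
  funext fun j => by simp only [Function.comp_apply, Fin.append_right]

/-- **Corner split ⟺ self split.**  For `N ≤ m`, the level-`k` split hypothesis for the corner type `((k^N))³` in the ambient
format `m` (the shape of part W's `hES`, there with `m = m'+1`, `N = m'`, `k = 3`) is equivalent to the split hypothesis for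
the self type at format `N`: corner-type level vectors are exactly the lifts of self-type ones (part L), and secant polynomials
only see corner parts. [this node] -/
theorem cornerSplit_iff_selfSplit {N k : ℕ} (hNm : N ≤ m) :
    (∀ G ∈ hwvSpace (rectType m N k) (k * N), ∀ (n : ℕ) (x₁ x₂ x₃ : Fin n → Fin m → ℂ), (k - 1) * n = k * N →
      MvPolynomial.coeff (Finsupp.equivFunOnFinite.symm fun _ : Fin n => k - 1)
        (MvPolynomial.aeval (fun p : Idx m =>
          ∑ i : Fin n, MvPolynomial.C (triad (x₁ i) (x₂ i) (x₃ i) p.1 p.2.1 p.2.2) * MvPolynomial.X i) G) = 0) ↔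
    (∀ g ∈ hwvSpace (rectType N N k) (k * N), ∀ (n : ℕ) (x₁ x₂ x₃ : Fin n → Fin N → ℂ), (k - 1) * n = k * N →
      MvPolynomial.coeff (Finsupp.equivFunOnFinite.symm fun _ : Fin n => k - 1)
        (MvPolynomial.aeval (fun p : Idx N =>
          ∑ i : Fin n, MvPolynomial.C (triad (x₁ i) (x₂ i) (x₃ i) p.1 p.2.1 p.2.2) * MvPolynomial.X i) g) = 0) := by
  obtain ⟨d, rfl⟩ : ∃ d, m = d + N := ⟨m - N, by omega⟩
  constructor
  · intro H g hg n x₁ x₂ x₃ hn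
    have hG : liftPoly d g ∈ hwvSpace (rectType (d + N) N k) (k * N) := by
      rw [← liftType_rectType (le_refl N) k]
      exact liftPoly_mem_hwvSpace hg
    have h := H _ hG n (fun i => Fin.append (fun _ : Fin d => (0 : ℂ)) (x₁ i))
      (fun i => Fin.append (fun _ : Fin d => (0 : ℂ)) (x₂ i)) (fun i => Fin.append (fun _ : Fin d => (0 : ℂ)) (x₃ i)) hn
    rw [secant_liftPoly] at h
    simpa only [append_zero_comp_natAdd] using h
  · intro H G hG n x₁ x₂ x₃ hn
    obtain ⟨g, hg, rfl⟩ := exists_eq_liftPoly_of_mem_hwvSpace (le_refl N) hG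
    rw [secant_liftPoly]
    exact H g hg n _ _ _ hn

end FormatBookkeeping

/-! ### §5 Level 3: the even Strassen step -/

section EvenStep

variable {m' : ℕ}

/-- **THE EVEN-STEP LAW (level 3).**  Hypotheses: `3 ∈ emptyLevels m' m'` (`k_{m'}(3) = 0`) and H20 at format `m' + 1` in
self form — every level-`3` vector `g` of the full format `m' + 1` has vanishing `(2,…,2)`-coefficient in `g(Σ_{i<n} λ_i t_i)`
at `2n = 3(m'+1)` triads.  Conclusion: every level-`3` vector of format `m' + 1` vanishes at every tensor of rank `≤ r` with
`2r ≤ 3(m'+1)` — one more than part U's descent law `2r < 3(m'+1)` when `m' + 1` is even: `r_{m'+1}(3) ≥ 3(m'+1)/2 + 1`.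
[this node] -/
theorem evalT_eq_zero_of_evenStep (hk : 3 ∈ emptyLevels m' m')
    (hS : ∀ g ∈ hwvSpace (rectType (m' + 1) (m' + 1) 3) (3 * (m' + 1)), ∀ (n : ℕ) (x₁ x₂ x₃ : Fin n → Fin (m' + 1) → ℂ),
      2 * n = 3 * (m' + 1) → MvPolynomial.coeff (Finsupp.equivFunOnFinite.symm fun _ : Fin n => 2)
        (MvPolynomial.aeval (fun p : Idx (m' + 1) =>
          ∑ i : Fin n, MvPolynomial.C (triad (x₁ i) (x₂ i) (x₃ i) p.1 p.2.1 p.2.2) * MvPolynomial.X i) g) = 0)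
    {f : MvPolynomial (Idx (m' + 1)) ℂ} (hf : f ∈ hwvSpace (rectType (m' + 1) (m' + 1) 3) (3 * (m' + 1)))
    {r : ℕ} (hr : 2 * r ≤ 3 * (m' + 1)) {t : Tensor ℂ (m' + 1)} (ht : tensorRank t ≤ r) : evalT t f = 0 :=
  evalT_eq_zero_of_emptyLevel_pred_boundary (k := 3) hk hf (r := r) (by omega)
    (fun x₁ x₂ x₃ h => hS f hf r x₁ x₂ x₃ (by omega)) ht

/-- **Even-step law, corner form** at every ambient format `m ≥ m' + 1`. [this node] -/
theorem evalT_eq_zero_of_evenStep_corner {m : ℕ} (hNm : m' + 1 ≤ m) (hk : 3 ∈ emptyLevels m' m')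
    (hS : ∀ g ∈ hwvSpace (rectType (m' + 1) (m' + 1) 3) (3 * (m' + 1)), ∀ (n : ℕ) (x₁ x₂ x₃ : Fin n → Fin (m' + 1) → ℂ),
      2 * n = 3 * (m' + 1) → MvPolynomial.coeff (Finsupp.equivFunOnFinite.symm fun _ : Fin n => 2)
        (MvPolynomial.aeval (fun p : Idx (m' + 1) =>
          ∑ i : Fin n, MvPolynomial.C (triad (x₁ i) (x₂ i) (x₃ i) p.1 p.2.1 p.2.2) * MvPolynomial.X i) g) = 0)
    {F : MvPolynomial (Idx m) ℂ} (hF : F ∈ hwvSpace (rectType m (m' + 1) 3) (3 * (m' + 1)))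
    {r : ℕ} (hr : 2 * r ≤ 3 * (m' + 1)) {t : Tensor ℂ m} (ht : tensorRank t ≤ r) : evalT t F = 0 := by
  obtain ⟨d, rfl⟩ : ∃ d, m = d + (m' + 1) := ⟨m - (m' + 1), by omega⟩
  obtain ⟨f, hf, rfl⟩ := exists_eq_liftPoly_of_mem_hwvSpace le_rfl hF
  rw [evalT_liftPoly]
  exact evalT_eq_zero_of_evenStep hk hS hf hr ((tensorRank_cornerOf_le d t).trans ht)

/-- Level language: under the even-step hypotheses, `3` is not a level of any tensor of format `m' + 1` and rank `≤ r`,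
`2r ≤ 3(m'+1)`. [this node] -/
theorem three_not_mem_pointLevels_of_evenStep (hk : 3 ∈ emptyLevels m' m')
    (hS : ∀ g ∈ hwvSpace (rectType (m' + 1) (m' + 1) 3) (3 * (m' + 1)), ∀ (n : ℕ) (x₁ x₂ x₃ : Fin n → Fin (m' + 1) → ℂ),
      2 * n = 3 * (m' + 1) → MvPolynomial.coeff (Finsupp.equivFunOnFinite.symm fun _ : Fin n => 2)
        (MvPolynomial.aeval (fun p : Idx (m' + 1) =>
          ∑ i : Fin n, MvPolynomial.C (triad (x₁ i) (x₂ i) (x₃ i) p.1 p.2.1 p.2.2) * MvPolynomial.X i) g) = 0)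
    {r : ℕ} (hr : 2 * r ≤ 3 * (m' + 1)) {t : Tensor ℂ (m' + 1)} (ht : tensorRank t ≤ r) :
    3 ∉ pointLevels (m' + 1) t := by
  rintro ⟨f, hf, hne⟩
  exact hne (evalT_eq_zero_of_evenStep hk hS hf hr ht)

/-- Orbit language: under the even-step hypotheses, level `3` of block format `m' + 1` (ambient `m ≥ m' + 1`) lies in the
ideal of `GL_m³·u` for every `u` of rank `≤ r`, `2r ≤ 3(m'+1)`. [this node] -/
theorem hwvSpace_le_orbitVanishing_of_evenStep {m : ℕ} (hNm : m' + 1 ≤ m) (hk : 3 ∈ emptyLevels m' m')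
    (hS : ∀ g ∈ hwvSpace (rectType (m' + 1) (m' + 1) 3) (3 * (m' + 1)), ∀ (n : ℕ) (x₁ x₂ x₃ : Fin n → Fin (m' + 1) → ℂ),
      2 * n = 3 * (m' + 1) → MvPolynomial.coeff (Finsupp.equivFunOnFinite.symm fun _ : Fin n => 2)
        (MvPolynomial.aeval (fun p : Idx (m' + 1) =>
          ∑ i : Fin n, MvPolynomial.C (triad (x₁ i) (x₂ i) (x₃ i) p.1 p.2.1 p.2.2) * MvPolynomial.X i) g) = 0)
    {r : ℕ} (hr : 2 * r ≤ 3 * (m' + 1)) {u : Tensor ℂ m} (hu : tensorRank u ≤ r) :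
    hwvSpace (rectType m (m' + 1) 3) (3 * (m' + 1)) ≤ orbitVanishing u := by
  intro F hF A B C _ _ _
  exact evalT_eq_zero_of_evenStep_corner hNm hk hS hF hr ((tensorRestrictsTo_actTensor A B C u).tensorRank_le.trans hu)

/-- Passing-level language: under the even-step hypotheses, level `3` of block format `m' + 1` does not pass at any ambient
format `m` with `m' + 1 ≤ m` and `2m ≤ 3(m'+1)`. [this node] -/
theorem three_not_mem_passLevels_of_evenStep {m : ℕ} (hNm : m' + 1 ≤ m) (hm : 2 * m ≤ 3 * (m' + 1))
    (hk : 3 ∈ emptyLevels m' m')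
    (hS : ∀ g ∈ hwvSpace (rectType (m' + 1) (m' + 1) 3) (3 * (m' + 1)), ∀ (n : ℕ) (x₁ x₂ x₃ : Fin n → Fin (m' + 1) → ℂ),
      2 * n = 3 * (m' + 1) → MvPolynomial.coeff (Finsupp.equivFunOnFinite.symm fun _ : Fin n => 2)
        (MvPolynomial.aeval (fun p : Idx (m' + 1) =>
          ∑ i : Fin n, MvPolynomial.C (triad (x₁ i) (x₂ i) (x₃ i) p.1 p.2.1 p.2.2) * MvPolynomial.X i) g) = 0) :
    3 ∉ passLevels m (m' + 1) := fun h =>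
  h (hwvSpace_le_orbitVanishing_of_evenStep hNm hk hS hm (tensorRank_unitTensor_le' m))

/-- **At the boundary the split hypothesis is the whole obstruction (equivalence).**  Given `3 ∈ emptyLevels m' m'` and
`2r = 3(m'+1)`: every level-`3` vector of format `m' + 1` vanishes on all tensors of rank `≤ r` IF AND ONLY IF H20 holds at
format `m' + 1` (self form).  The «only if» direction uses no emptiness (§1). [this node] -/
theorem level_three_vanishing_iff_selfSplit (hk : 3 ∈ emptyLevels m' m') {r : ℕ} (hr : 2 * r = 3 * (m' + 1)) :
    (∀ f ∈ hwvSpace (rectType (m' + 1) (m' + 1) 3) (3 * (m' + 1)), ∀ t : Tensor ℂ (m' + 1),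
      tensorRank t ≤ r → evalT t f = 0) ↔
    (∀ g ∈ hwvSpace (rectType (m' + 1) (m' + 1) 3) (3 * (m' + 1)), ∀ (n : ℕ) (x₁ x₂ x₃ : Fin n → Fin (m' + 1) → ℂ),
      2 * n = 3 * (m' + 1) → MvPolynomial.coeff (Finsupp.equivFunOnFinite.symm fun _ : Fin n => 2)
        (MvPolynomial.aeval (fun p : Idx (m' + 1) =>
          ∑ i : Fin n, MvPolynomial.C (triad (x₁ i) (x₂ i) (x₃ i) p.1 p.2.1 p.2.2) * MvPolynomial.X i) g) = 0) := by
  constructor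
  · intro H g hg n x₁ x₂ x₃ hn
    obtain rfl : n = r := by omega
    exact coeff_secant_eq_zero_of_vanish (fun t ht => H g hg t ht) x₁ x₂ x₃ _
  · intro hS f hf t ht
    exact evalT_eq_zero_of_evenStep hk hS hf hr.le ht

/-- **H20-self is necessary, unconditionally.**  If every level-`3` vector of format `N` vanishes on all tensors of rank
`≤ r` with `2r = 3N`, then H20 holds at format `N` (self form) — no emptiness hypothesis. [this node] -/
theorem selfSplit_of_level_three_vanishing {N r : ℕ} (hr : 2 * r = 3 * N)
    (H : ∀ f ∈ hwvSpace (rectType N N 3) (3 * N), ∀ t : Tensor ℂ N, tensorRank t ≤ r → evalT t f = 0) :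
    ∀ g ∈ hwvSpace (rectType N N 3) (3 * N), ∀ (n : ℕ) (x₁ x₂ x₃ : Fin n → Fin N → ℂ),
      2 * n = 3 * N → MvPolynomial.coeff (Finsupp.equivFunOnFinite.symm fun _ : Fin n => 2)
        (MvPolynomial.aeval (fun p : Idx N =>
          ∑ i : Fin n, MvPolynomial.C (triad (x₁ i) (x₂ i) (x₃ i) p.1 p.2.1 p.2.2) * MvPolynomial.X i) g) = 0 := by
  intro g hg n x₁ x₂ x₃ hn
  obtain rfl : n = r := by omega
  exact coeff_secant_eq_zero_of_vanish (fun t ht => H g hg t ht) x₁ x₂ x₃ _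

/-- **Vacuity at odd formats.**  If the format `N` is odd, `2n = 3N` has no solution and H20-self at format `N` holds
vacuously: the even step carries content only at even formats (at odd formats part W's odd step is the boundary law).
[bookkeeping] -/
theorem selfSplit_of_odd_format {N : ℕ} (hN : Odd N) :
    ∀ g ∈ hwvSpace (rectType N N 3) (3 * N), ∀ (n : ℕ) (x₁ x₂ x₃ : Fin n → Fin N → ℂ),
      2 * n = 3 * N → MvPolynomial.coeff (Finsupp.equivFunOnFinite.symm fun _ : Fin n => 2)
        (MvPolynomial.aeval (fun p : Idx N =>
          ∑ i : Fin n, MvPolynomial.C (triad (x₁ i) (x₂ i) (x₃ i) p.1 p.2.1 p.2.2) * MvPolynomial.X i) g) = 0 := by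
  intro g _ n x₁ x₂ x₃ hn
  exfalso
  obtain ⟨j, hj⟩ := hN
  omega

/-- H20 in part W's corner shape at `(m'+1, m')` is H20-self at format `m'` (an instance of `cornerSplit_iff_selfSplit`):
the hypothesis `hES` of part W's `evalT_eq_zero_of_evenSplit_pred` and the hypothesis `hS` of this file's even step, ONE
FORMAT APART, are literally the same family of statements H20(`N`), `N = m', m' + 1`. [bookkeeping] -/
theorem evenSplit_corner_iff_self :
    (∀ G ∈ hwvSpace (rectType (m' + 1) m' 3) (3 * m'), ∀ (n : ℕ) (x₁ x₂ x₃ : Fin n → Fin (m' + 1) → ℂ),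
      2 * n = 3 * m' → MvPolynomial.coeff (Finsupp.equivFunOnFinite.symm fun _ : Fin n => 2)
        (MvPolynomial.aeval (fun p : Idx (m' + 1) =>
          ∑ i : Fin n, MvPolynomial.C (triad (x₁ i) (x₂ i) (x₃ i) p.1 p.2.1 p.2.2) * MvPolynomial.X i) G) = 0) ↔
    (∀ g ∈ hwvSpace (rectType m' m' 3) (3 * m'), ∀ (n : ℕ) (x₁ x₂ x₃ : Fin n → Fin m' → ℂ),
      2 * n = 3 * m' → MvPolynomial.coeff (Finsupp.equivFunOnFinite.symm fun _ : Fin n => 2)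
        (MvPolynomial.aeval (fun p : Idx m' =>
          ∑ i : Fin n, MvPolynomial.C (triad (x₁ i) (x₂ i) (x₃ i) p.1 p.2.1 p.2.2) * MvPolynomial.X i) g) = 0) :=
  cornerSplit_iff_selfSplit (k := 3) (Nat.le_succ m')

/-! #### The instance `N = 8`: `r₈(3) ≥ 13` from `k₇(3) = 0` and H20(8) -/

/-- **`R₃(8) ⊆ I(σ₁₂)` from the two named census facts** `k₇(3) = 0` (`3 ∈ emptyLevels 7 7`, Kronecker coefficient
`g((3⁷),(3⁷),(3⁷)) = 0`) and H20(8) (census K25 slot-character law; lens-3 (E5)): every level-`3` vector of format `8`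
(degree `24`) vanishes at every tensor of rank `≤ 12`. [this node] -/
theorem evalT_eq_zero_of_level_three_eight (hk7 : 3 ∈ emptyLevels 7 7)
    (hS8 : ∀ g ∈ hwvSpace (rectType 8 8 3) (3 * 8), ∀ (n : ℕ) (x₁ x₂ x₃ : Fin n → Fin 8 → ℂ),
      2 * n = 3 * 8 → MvPolynomial.coeff (Finsupp.equivFunOnFinite.symm fun _ : Fin n => 2)
        (MvPolynomial.aeval (fun p : Idx 8 =>
          ∑ i : Fin n, MvPolynomial.C (triad (x₁ i) (x₂ i) (x₃ i) p.1 p.2.1 p.2.2) * MvPolynomial.X i) g) = 0)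
    {f : MvPolynomial (Idx 8) ℂ} (hf : f ∈ hwvSpace (rectType 8 8 3) (3 * 8)) {t : Tensor ℂ 8}
    (ht : tensorRank t ≤ 12) : evalT t f = 0 :=
  evalT_eq_zero_of_evenStep (m' := 7) hk7 hS8 hf (r := 12) (by norm_num) ht

/-- **`r₈(3) ≥ 13`** (census K25: `= 13` exactly — the one format where the naive law `r_N(3) = ⌈3N/2⌉` fails): a level-`3`
vector of format `8` that does not vanish at `t` certifies `R(t) ≥ 13`, given `k₇(3) = 0` and H20(8). [this node] -/
theorem thirteen_le_tensorRank_of_level_three_eight (hk7 : 3 ∈ emptyLevels 7 7)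
    (hS8 : ∀ g ∈ hwvSpace (rectType 8 8 3) (3 * 8), ∀ (n : ℕ) (x₁ x₂ x₃ : Fin n → Fin 8 → ℂ),
      2 * n = 3 * 8 → MvPolynomial.coeff (Finsupp.equivFunOnFinite.symm fun _ : Fin n => 2)
        (MvPolynomial.aeval (fun p : Idx 8 =>
          ∑ i : Fin n, MvPolynomial.C (triad (x₁ i) (x₂ i) (x₃ i) p.1 p.2.1 p.2.2) * MvPolynomial.X i) g) = 0)
    {f : MvPolynomial (Idx 8) ℂ} (hf : f ∈ hwvSpace (rectType 8 8 3) (3 * 8)) {t : Tensor ℂ 8}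
    (hne : evalT t f ≠ 0) : 13 ≤ tensorRank t := by
  by_contra h
  exact hne (evalT_eq_zero_of_level_three_eight hk7 hS8 hf (by omega))

/-- Conversely `R₃(8) ⊆ I(σ₁₂)` implies H20(8) outright (§1): given `k₇(3) = 0`, **H20(8) ⟺ r₈(3) ≥ 13**. [this node] -/
theorem level_three_eight_vanishing_iff (hk7 : 3 ∈ emptyLevels 7 7) :
    (∀ f ∈ hwvSpace (rectType 8 8 3) (3 * 8), ∀ t : Tensor ℂ 8, tensorRank t ≤ 12 → evalT t f = 0) ↔
    (∀ g ∈ hwvSpace (rectType 8 8 3) (3 * 8), ∀ (n : ℕ) (x₁ x₂ x₃ : Fin n → Fin 8 → ℂ),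
      2 * n = 3 * 8 → MvPolynomial.coeff (Finsupp.equivFunOnFinite.symm fun _ : Fin n => 2)
        (MvPolynomial.aeval (fun p : Idx 8 =>
          ∑ i : Fin n, MvPolynomial.C (triad (x₁ i) (x₂ i) (x₃ i) p.1 p.2.1 p.2.2) * MvPolynomial.X i) g) = 0) :=
  level_three_vanishing_iff_selfSplit (m' := 7) hk7 (r := 12) (by norm_num)

end EvenStep

end Summit.MatrixMultiplication.MatrixMultiplication.Theorems.ObstructionCalculus
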